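import Mathlib
import HarnessLib
import Summits.AnomalousDissipation.AnomalousDissipation.Theses.TaylorCertificates
import Literature.Analysis.FluidPDE.StatisticalSolution
import Literature.Analysis.FunctionSpaces.TorusTrigPoly

/-!
# Sketch — crux-ideate round 1, ideator 2, crux `TaylorCertificates.FloorCertificateEnsembleCeiling`
(stmt-AnomalousDissipation-14086, the route's rank-0 target X, auto-cruxed)

First lemmas (statements; the logic glue is PROVED) of the two crux idea cards of this seat:

* `uniform-friction-certificate` — ONE taxed floor inequality
  `ε₁ + κ|u|² ≤ ν‖∇u‖² + ⟨F(u),Ψ'(u)⟩ + α((f,u) − ν‖∇u‖²)` decides BOTH halves of X (floor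
  directly, ceiling by weak duality + the kinematic injection bound `ε ≤ ‖f‖·U`);
* `priced-super-resolution` — in X's unrestricted class the subgrid tail is priced EXACTLY
  (cross terms by completing the square against the Leray ball), so floor certificates are
  priced Galerkin certificates for one truncation `K(ν) = poly(ν⁻¹)`.
-/

noncomputable section

namespace Summit.AnomalousDissipation.AnomalousDissipation.Cruxes.FloorCertificateEnsembleCeiling.Ideator2

open MeasureTheory
open scoped InnerProductSpace RealInnerProductSpace ENNReal
open Literature.Analysis.FunctionSpaces.Torus
open Literature.Analysis.FluidPDE.Torus

local notation "𝕋³" => UnitAddTorus (Fin 3)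
local notation "E³" => EuclideanSpace ℝ (Fin 3)
local notation "H³" => Literature.Analysis.FunctionSpaces.Torus.energySpace (Fin 3)
local notation "L2T" => Lp (EuclideanSpace ℝ (Fin 3)) 2 (volume : Measure (UnitAddTorus (Fin 3)))

/-! ## The crux body, split into its two blocks -/

/-- FLOOR block of X at one viscosity (verbatim the first conjunct of the route decl's body). -/
def FloorAt (f : 𝕋³ → E³) (ε₀ ν : ℝ) : Prop :=
  ∃ (Φ₁ : Literature.Analysis.FluidPDE.Torus.CylindricalTest (Fin 3)) (θ₁ : ℝ), θ₁ ≤ 0 ∧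
    ∀ u : Literature.Analysis.FunctionSpaces.Torus.energySpace (Fin 3),
      let uf : UnitAddTorus (Fin 3) → EuclideanSpace ℝ (Fin 3) :=
        ((u : MeasureTheory.Lp (EuclideanSpace ℝ (Fin 3)) 2
          (MeasureTheory.volume : MeasureTheory.Measure (UnitAddTorus (Fin 3)))) :
            UnitAddTorus (Fin 3) → EuclideanSpace ℝ (Fin 3))
      let D : ℝ := ν * (Literature.Analysis.FunctionSpaces.Torus.eGradNormSq uf).toReal
      let P : ℝ := Literature.Analysis.FluidPDE.Torus.pairing
        (u : MeasureTheory.Lp (EuclideanSpace ℝ (Fin 3)) 2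
          (MeasureTheory.volume : MeasureTheory.Measure (UnitAddTorus (Fin 3)))) f - D
      Literature.Analysis.FunctionSpaces.Torus.eGradNormSq uf ≠ ⊤ →
        ‖u‖ ^ 2 ≤ 16 * (∫ x, ‖f x‖ ^ 2) / ν ^ 2 →
          ε₀ ≤ D + Literature.Analysis.FluidPDE.Torus.nsGeneratorPairing ν f u (Φ₁.grad u) + 2 * θ₁ * P

/-- CEILING block of X at one viscosity (verbatim the second conjunct). -/
def CeilAt (f : 𝕋³ → E³) (E ν : ℝ) : Prop :=
  ∀ μ : MeasureTheory.Measure (Literature.Analysis.FunctionSpaces.Torus.energySpace (Fin 3)),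
    Literature.Analysis.FluidPDE.Torus.IsStationaryStatisticalSolution ν f μ →
      MeasureTheory.Integrable
        (fun v : Literature.Analysis.FunctionSpaces.Torus.energySpace (Fin 3) => ‖v‖ ^ 2) μ →
        Literature.Analysis.FluidPDE.Torus.ensembleEnergy μ ≤ E

/-- X re-assembled from its blocks. -/
def X' : Prop :=
  ∃ f : 𝕋³ → E³, IsSmooth f ∧ IsDivFree f ∧ HasZeroMean f ∧
    ∃ (ε₀ E ν₀ : ℝ), 0 < ε₀ ∧ 0 < ν₀ ∧ ∀ ν : ℝ, 0 < ν → ν < ν₀ → FloorAt f ε₀ ν ∧ CeilAt f E ν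

/-- Sanity: `X'` IS the route decl (definitional). -/
theorem x'_iff :
    X' ↔ Summit.AnomalousDissipation.AnomalousDissipation.Theses.TaylorCertificates.FloorCertificateEnsembleCeiling :=
  Iff.rfl

/-! ## Card `uniform-friction-certificate` — one taxed floor inequality decides X -/

/-- The TAXED FLOOR at one viscosity: a cylindrical `Ψ` and a weight `α ≤ 0` such that on the
finite-enstrophy Leray ball
`ε₁ + κ|u|² ≤ ν‖∇u‖² + ⟨F(u), Ψ'(u)⟩ + α((f,u) − ν‖∇u‖²)`.
For `κ = 0` this is exactly `FloorAt` (with `θ₁ = α/2`); `κ > 0` is the ENERGY TAX that, through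
weak duality and `ε ≤ ‖f‖ U`, pays for the ceiling. Dual reading: every (relaxed) stationary
statistic of `NS_ν(f)` obeys `ε(μ) ≥ ε₁ + κ·U²(μ)` — a ν-UNIFORM EFFECTIVE FRICTION RATE `κ`. -/
def TaxedFloorAt (f : 𝕋³ → E³) (ε₁ κ ν : ℝ) : Prop :=
  ∃ (Ψ : Literature.Analysis.FluidPDE.Torus.CylindricalTest (Fin 3)) (α : ℝ), α ≤ 0 ∧
    ∀ u : Literature.Analysis.FunctionSpaces.Torus.energySpace (Fin 3),
      let uf : UnitAddTorus (Fin 3) → EuclideanSpace ℝ (Fin 3) :=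
        ((u : MeasureTheory.Lp (EuclideanSpace ℝ (Fin 3)) 2
          (MeasureTheory.volume : MeasureTheory.Measure (UnitAddTorus (Fin 3)))) :
            UnitAddTorus (Fin 3) → EuclideanSpace ℝ (Fin 3))
      let D : ℝ := ν * (Literature.Analysis.FunctionSpaces.Torus.eGradNormSq uf).toReal
      let P : ℝ := Literature.Analysis.FluidPDE.Torus.pairing
        (u : MeasureTheory.Lp (EuclideanSpace ℝ (Fin 3)) 2
          (MeasureTheory.volume : MeasureTheory.Measure (UnitAddTorus (Fin 3)))) f - D
      Literature.Analysis.FunctionSpaces.Torus.eGradNormSq uf ≠ ⊤ →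
        ‖u‖ ^ 2 ≤ 16 * (∫ x, ‖f x‖ ^ 2) / ν ^ 2 →
          ε₁ + κ * ‖u‖ ^ 2 ≤
            D + Literature.Analysis.FluidPDE.Torus.nsGeneratorPairing ν f u (Ψ.grad u) + α * P

/-- TRANSFER C⁺ of the card: ONE force with a ν-uniform taxed floor. -/
def UniformFriction : Prop :=
  ∃ f : 𝕋³ → E³, IsSmooth f ∧ IsDivFree f ∧ HasZeroMean f ∧
    ∃ (ε₁ κ ν₀ : ℝ), 0 < ε₁ ∧ 0 < κ ∧ 0 < ν₀ ∧ ∀ ν : ℝ, 0 < ν → ν < ν₀ → TaxedFloorAt f ε₁ κ ν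

/-- (a) PROVED: a taxed floor with `κ ≥ 0` is in particular X's floor block (`θ₁ := α/2`). -/
theorem floorAt_of_taxed {f : 𝕋³ → E³} {ε₁ κ ν : ℝ} (hκ : 0 ≤ κ) :
    TaxedFloorAt f ε₁ κ ν → FloorAt f ε₁ ν := by
  rintro ⟨Ψ, α, hα, h⟩
  refine ⟨Ψ, α / 2, by linarith, fun u => ?_⟩
  intro uf D P hfin hball
  have h1 := h u hfin hball
  have hnn : 0 ≤ κ * ‖u‖ ^ 2 := mul_nonneg hκ (sq_nonneg _)
  have h2 : 2 * (α / 2) * P = α * P := by ring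
  rw [h2]
  linarith

/-- (b) FIRST LEMMA (analysis, M-sized; the `κ = 0` case is the LANDED
`Theorems/FloorCertificate/Negative/WeakDuality.floorFamily_le_ensembleDissipation`): weak duality
WITH TAX. For a stationary statistical solution `μ` of `NS_ν(f)` with integrable energy, integrating
the taxed floor over `μ` — Liouville kills `⟨F,Ψ'⟩` (FMRT (1.30)), the energy inequality (1.31) and
`α ≤ 0` kill `α(J − D)`, the support bound `|u| ≤ ‖f‖/(4π²ν)` keeps `μ` inside the Leray ball, finite
mean enstrophy makes the floor hypothesis hold `μ`-a.e. — gives `ε₁ + κ U² ≤ ε(μ) = ν∫‖∇u‖²dμ`. -/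
def TaxedWeakDuality : Prop :=
  ∀ (ν ε₁ κ : ℝ) (f : 𝕋³ → E³)
    (μ : MeasureTheory.Measure (Literature.Analysis.FunctionSpaces.Torus.energySpace (Fin 3))),
    0 < ν → IsSmooth f → IsDivFree f → HasZeroMean f → 0 ≤ κ →
    TaxedFloorAt f ε₁ κ ν →
    Literature.Analysis.FluidPDE.Torus.IsStationaryStatisticalSolution ν f μ →
    MeasureTheory.Integrable
      (fun v : Literature.Analysis.FunctionSpaces.Torus.energySpace (Fin 3) => ‖v‖ ^ 2) μ →
      ε₁ + κ * Literature.Analysis.FluidPDE.Torus.ensembleEnergy μ ≤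
        ν * (Literature.Analysis.FluidPDE.Torus.ensembleEnstrophy μ).toReal

/-- (c) KINEMATIC INJECTION BOUND (provable now from the tree fact
`IsStationaryStatisticalSolution.energy_le` + Cauchy–Schwarz twice):
`ε(μ) = ν∫‖∇u‖² ≤ ∫(f,u) ≤ ‖f‖₂ · (∫|u|²)^{1/2}`. -/
def InjectionBound : Prop :=
  ∀ (ν : ℝ) (f : 𝕋³ → E³)
    (μ : MeasureTheory.Measure (Literature.Analysis.FunctionSpaces.Torus.energySpace (Fin 3))),
    0 < ν → IsSmooth f →
    Literature.Analysis.FluidPDE.Torus.IsStationaryStatisticalSolution ν f μ →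
    MeasureTheory.Integrable
      (fun v : Literature.Analysis.FunctionSpaces.Torus.energySpace (Fin 3) => ‖v‖ ^ 2) μ →
      ν * (Literature.Analysis.FluidPDE.Torus.ensembleEnstrophy μ).toReal ≤
        Real.sqrt (∫ x, ‖f x‖ ^ 2) * Real.sqrt (Literature.Analysis.FluidPDE.Torus.ensembleEnergy μ)

/-- (d) PROVED: the friction algebra — `κ a² ≤ e ≤ F a`, `a ≥ 0`, `κ > 0` force `a² ≤ (F/κ)²`. -/
theorem sq_le_of_friction {κ a F e : ℝ} (hκ : 0 < κ) (ha : 0 ≤ a) (hF : 0 ≤ F)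
    (h1 : κ * a ^ 2 ≤ e) (h2 : e ≤ F * a) : a ^ 2 ≤ (F / κ) ^ 2 := by
  have h3 : κ * a ^ 2 ≤ F * a := le_trans h1 h2
  have h4 : a ≤ F / κ := by
    rw [le_div_iff₀ hκ]
    rcases eq_or_lt_of_le ha with h0 | hpos
    · rw [← h0]; simp; positivity
    · nlinarith
  exact pow_le_pow_left₀ ha h4 2

/-- (e) PROVED (assembly of the card): the taxed floor of ONE force decides X —
`UniformFriction → TaxedWeakDuality → InjectionBound → X`, with `ε₀ := ε₁` and
`E := (‖f‖₂/κ)²`. The same-force coupling of X (items #0/#7) is automatic: one `f`, one `Ψ`. -/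
theorem x_of_uniformFriction (hW : TaxedWeakDuality) (hI : InjectionBound) :
    UniformFriction →
      Summit.AnomalousDissipation.AnomalousDissipation.Theses.TaylorCertificates.FloorCertificateEnsembleCeiling := by
  rintro ⟨f, hfs, hfd, hfz, ε₁, κ, ν₀, hε₁, hκ, hν₀, h⟩
  rw [← x'_iff]
  refine ⟨f, hfs, hfd, hfz, ε₁, (Real.sqrt (∫ x, ‖f x‖ ^ 2) / κ) ^ 2, ν₀, hε₁, hν₀,
    fun ν hν hνlt => ⟨floorAt_of_taxed hκ.le (h ν hν hνlt), fun μ hμ hint => ?_⟩⟩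
  have hT := h ν hν hνlt
  have hd := hW ν ε₁ κ f μ hν hfs hfd hfz hκ.le hT hμ hint
  have hi := hI ν f μ hν hfs hμ hint
  have hEnn : 0 ≤ Literature.Analysis.FluidPDE.Torus.ensembleEnergy μ := by
    unfold Literature.Analysis.FluidPDE.Torus.ensembleEnergy
    exact integral_nonneg fun v => by positivity
  set a : ℝ := Real.sqrt (Literature.Analysis.FluidPDE.Torus.ensembleEnergy μ) with ha_def
  have ha : 0 ≤ a := Real.sqrt_nonneg _
  have ha2 : a ^ 2 = Literature.Analysis.FluidPDE.Torus.ensembleEnergy μ := Real.sq_sqrt hEnn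
  have h1 : κ * a ^ 2 ≤ ν * (Literature.Analysis.FluidPDE.Torus.ensembleEnstrophy μ).toReal := by
    rw [ha2]; linarith
  have := sq_le_of_friction hκ ha (Real.sqrt_nonneg _) h1 hi
  rw [ha2] at this
  exact this

/-! ## Card `priced-super-resolution` — the tail is priced exactly in the unrestricted class -/

/-- The `L²` representative of a state. -/
def rep (u : H³) : 𝕋³ → E³ := ((u : L2T) : 𝕋³ → E³)

/-- The floor functional of X at a state (its `let`-bound body, named). -/
def floorLHS (ν : ℝ) (f : 𝕋³ → E³) (Φ : Literature.Analysis.FluidPDE.Torus.CylindricalTest (Fin 3))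
    (θ : ℝ) (u : H³) : ℝ :=
  ν * (eGradNormSq (rep u)).toReal +
    Literature.Analysis.FluidPDE.Torus.nsGeneratorPairing ν f u (Φ.grad u) +
      2 * θ * (Literature.Analysis.FluidPDE.Torus.pairing (u : L2T) f - ν * (eGradNormSq (rep u)).toReal)

/-- `FloorAt` in terms of `floorLHS` (definitional). -/
theorem floorAt_iff (f : 𝕋³ → E³) (ε₀ ν : ℝ) :
    FloorAt f ε₀ ν ↔
      ∃ (Φ₁ : Literature.Analysis.FluidPDE.Torus.CylindricalTest (Fin 3)) (θ₁ : ℝ), θ₁ ≤ 0 ∧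
        ∀ u : H³, eGradNormSq (rep u) ≠ ⊤ → ‖u‖ ^ 2 ≤ 16 * (∫ x, ‖f x‖ ^ 2) / ν ^ 2 →
          ε₀ ≤ floorLHS ν f Φ₁ θ₁ u :=
  Iff.rfl

/-- A cylindrical test functional is BAND-LIMITED at `K` when its test fields are trigonometric
polynomials of degree `≤ K` (then `Φ'(u)` has degree `≤ K` and depends on `P_K u` only). -/
def IsBandLimited (K : ℕ) (Φ : Literature.Analysis.FluidPDE.Torus.CylindricalTest (Fin 3)) : Prop :=
  ∀ i, fourierTruncate K (Φ.g i) = Φ.g i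

/-- STEEPNESS of a certificate on the ball `|u|² ≤ ρ`: the strain of the multiplier field
`Φ'(u)` is bounded in operator norm by `M`, uniformly over the ball. This is the quantity the
tail must be priced against. -/
def StrainBound (Φ : Literature.Analysis.FluidPDE.Torus.CylindricalTest (Fin 3)) (ρ M : ℝ) : Prop :=
  ∀ u : H³, ‖u‖ ^ 2 ≤ ρ → ∀ (x : 𝕋³) (η : E³),
    ‖Literature.Analysis.FunctionSpaces.Torus.fderiv (Φ.grad u) x η‖ ≤ M * ‖η‖

/-- The TAIL DEFECT: completing the square in the cross term `∫(a⊗b + b⊗a):∇Φ'(a)`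
(`≤ 2M|a||b| ≤ 2M√ρ|b|`) against the priced tail dissipation
`((1 − 2θ)·4π²νK² − M)|b|²` (`b = u − P_K u` has frequencies `> K`). -/
def tailDefect (ν : ℝ) (K : ℕ) (θ M ρ : ℝ) : ℝ :=
  (2 * M * Real.sqrt ρ) ^ 2 / (4 * ((1 - 2 * θ) * (4 * Real.pi ^ 2 * ν * (K : ℝ) ^ 2) - M))

/-- FIRST LEMMA of the card (elementary Fourier analysis, M-sized in Lean): **exact tail pricing
for the unrestricted class.** Let `f` and `Φ` be band-limited at `K`, `θ ≤ 0`, `Φ` of steepness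
`M` on the ball `ρ`, with `M < (1 − 2θ)4π²νK²`. For a finite-enstrophy state `u` in the ball and
its Galerkin companion `a` (`rep a = P_K(rep u)` a.e.; `a` is again in `H`, in the ball, of finite
enstrophy), writing `b = u − a`:
`floorLHS(u) = floorLHS(a) + (1 − 2θ)ν‖∇b‖² + ∫(a⊗b + b⊗a + b⊗b):∇Φ'(a)` (coordinates, hence
`Φ'`, agree at `u` and `a`; `(f,b) = (b, ΔΦ') = 0` by band separation; Parseval splits `‖∇u‖²`),
and therefore `floorLHS(u) ≥ floorLHS(a) − tailDefect`. The Galerkin value `floorLHS(a)` is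
VERBATIM the floor functional of the Galerkin-`K` ODE `ȧ = P_K[f − νAa − B(a,a)]`. -/
def TailPricingFloor : Prop :=
  ∀ (ν : ℝ) (K : ℕ) (f : 𝕋³ → E³) (Φ : Literature.Analysis.FluidPDE.Torus.CylindricalTest (Fin 3))
    (θ M ρ : ℝ) (u a : H³),
    0 < ν → IsSmooth f → fourierTruncate K f = f → IsBandLimited K Φ → θ ≤ 0 → 0 ≤ M → 0 ≤ ρ →
    StrainBound Φ ρ M → M < (1 - 2 * θ) * (4 * Real.pi ^ 2 * ν * (K : ℝ) ^ 2) →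
    rep a =ᵐ[volume] fourierTruncate K (rep u) →
    eGradNormSq (rep u) ≠ ⊤ → ‖u‖ ^ 2 ≤ ρ →
      floorLHS ν f Φ θ a - tailDefect ν K θ M ρ ≤ floorLHS ν f Φ θ u

/-- Galerkin companions exist (provable now: `P_K` of an `H`-element is a solenoidal mean-zero
trigonometric polynomial, `isDivFree_fourierTruncate` + Bessel `integral_norm_sq_fourierTruncate_le`). -/
def TruncationCompanion : Prop :=
  ∀ (K : ℕ) (u : H³), ∃ a : H³, rep a =ᵐ[volume] fourierTruncate K (rep u) ∧ ‖a‖ ≤ ‖u‖ ∧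
    eGradNormSq (rep a) ≠ ⊤

/-- A PRICED GALERKIN FLOOR CERTIFICATE at resolution `K`: a band-limited `Φ`, `θ ≤ 0`, a steepness
budget `M` inside the price `(1−2θ)4π²νK²` with tail defect `≤ δ`, and the floor inequality with
margin `δ` required ONLY at Galerkin states (`a` a.e. equal to a `P_K`-truncation) of the ball —
a polynomial inequality on a ball of `ℝ^{dim P_K H}`. -/
def PricedGalerkinFloorAt (f : 𝕋³ → E³) (ε ν : ℝ) (K : ℕ) : Prop :=
  ∃ (Φ : Literature.Analysis.FluidPDE.Torus.CylindricalTest (Fin 3)) (θ M δ : ℝ),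
    IsBandLimited K Φ ∧ θ ≤ 0 ∧ 0 ≤ M ∧ 0 ≤ δ ∧
    StrainBound Φ (16 * (∫ x, ‖f x‖ ^ 2) / ν ^ 2) M ∧
    M < (1 - 2 * θ) * (4 * Real.pi ^ 2 * ν * (K : ℝ) ^ 2) ∧
    tailDefect ν K θ M (16 * (∫ x, ‖f x‖ ^ 2) / ν ^ 2) ≤ δ ∧
    ∀ (u a : H³), rep a =ᵐ[volume] fourierTruncate K (rep u) →
      eGradNormSq (rep a) ≠ ⊤ → ‖a‖ ^ 2 ≤ 16 * (∫ x, ‖f x‖ ^ 2) / ν ^ 2 →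
        ε + δ ≤ floorLHS ν f Φ θ a

/-- PROVED (the transfer, floor half): a priced Galerkin floor certificate IS a floor certificate
of X's unrestricted class for `NS_ν(f)` (given the tail-pricing lemma and companions). -/
theorem floorAt_of_pricedGalerkin (hT : TailPricingFloor) (hC : TruncationCompanion)
    {f : 𝕋³ → E³} (hf : IsSmooth f) {ν ε : ℝ} (hν : 0 < ν) {K : ℕ} (hfK : fourierTruncate K f = f) :
    PricedGalerkinFloorAt f ε ν K → FloorAt f ε ν := by
  rintro ⟨Φ, θ, M, δ, hband, hθ, hM, hδ, hstrain, hprice, hdef, hgal⟩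
  rw [floorAt_iff]
  refine ⟨Φ, θ, hθ, fun u hfin hball => ?_⟩
  obtain ⟨a, ha, hnorm, hafin⟩ := hC K u
  have hρ : 0 ≤ 16 * (∫ x, ‖f x‖ ^ 2) / ν ^ 2 := by positivity
  have haball : ‖a‖ ^ 2 ≤ 16 * (∫ x, ‖f x‖ ^ 2) / ν ^ 2 :=
    le_trans (pow_le_pow_left₀ (norm_nonneg _) hnorm 2) hball
  have h1 := hgal u a ha hafin haball
  have h2 := hT ν K f Φ θ M _ u a hν hf hfK hband hθ hM hρ hstrain hprice ha hfin hball
  linarith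

/-- The CEILING twin (statement only; same completed square, now the tail's `−|b|²` is priced by
`Λ·4π²νK² − 1 − M > 0`): a priced Galerkin ceiling certificate
`E − |a|² + ⟨F_K(a), Φ₂'(a)⟩ + Λ(ν‖∇a‖² − (f,a)) ≥ δ` on the Galerkin FMRT ball lifts to the same
pointwise inequality on `H` (defect `(2M√ρ')²/(4(Λ4π²νK² − 1 − M))`, `ρ' = ‖f‖²/(16π⁴ν²)` the FMRT
support radius²), whose weak-duality consequence over FMRT statistics is `CeilAt f E ν`
(Rosa–Temam arXiv:2010.06730 Thm 6.3 is the `Λ = 0` shape; the positive constant `Λ` uses only the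
global energy inequality (1.31)). -/
def PricedGalerkinCeilingLift : Prop :=
  ∀ (ν E : ℝ) (K : ℕ) (f : 𝕋³ → E³), 0 < ν → IsSmooth f → IsDivFree f → HasZeroMean f →
    fourierTruncate K f = f →
    (∃ (Φ₂ : Literature.Analysis.FluidPDE.Torus.CylindricalTest (Fin 3)) (Λ M δ : ℝ),
      IsBandLimited K Φ₂ ∧ 0 ≤ M ∧ 0 ≤ δ ∧
      StrainBound Φ₂ ((∫ x, ‖f x‖ ^ 2) / (16 * Real.pi ^ 4 * ν ^ 2)) M ∧
      1 + M < Λ * (4 * Real.pi ^ 2 * ν * (K : ℝ) ^ 2) ∧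
      (2 * M * Real.sqrt ((∫ x, ‖f x‖ ^ 2) / (16 * Real.pi ^ 4 * ν ^ 2))) ^ 2 /
          (4 * (Λ * (4 * Real.pi ^ 2 * ν * (K : ℝ) ^ 2) - 1 - M)) ≤ δ ∧
      ∀ (u a : H³), rep a =ᵐ[volume] fourierTruncate K (rep u) → eGradNormSq (rep a) ≠ ⊤ →
        ‖a‖ ^ 2 ≤ (∫ x, ‖f x‖ ^ 2) / (16 * Real.pi ^ 4 * ν ^ 2) →
          δ ≤ E - ‖a‖ ^ 2 +
            Literature.Analysis.FluidPDE.Torus.nsGeneratorPairing ν f a (Φ₂.grad a) +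
              Λ * (ν * (eGradNormSq (rep a)).toReal -
                Literature.Analysis.FluidPDE.Torus.pairing (a : L2T) f)) →
    CeilAt f E ν

/-- C⁺ of the card: ONE force whose super-resolved truncations carry BOTH priced certificates
(resolution `K` free at each `ν` — in practice `K(ν) = poly(ν⁻¹)` beyond the laminar sublayer). -/
def PricedGalerkinPair : Prop :=
  ∃ f : 𝕋³ → E³, IsSmooth f ∧ IsDivFree f ∧ HasZeroMean f ∧
    ∃ (ε₀ E ν₀ : ℝ), 0 < ε₀ ∧ 0 < ν₀ ∧ ∀ ν : ℝ, 0 < ν → ν < ν₀ →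
      ∃ K : ℕ, fourierTruncate K f = f ∧ PricedGalerkinFloorAt f ε₀ ν K ∧
        (∃ (Φ₂ : Literature.Analysis.FluidPDE.Torus.CylindricalTest (Fin 3)) (Λ M δ : ℝ),
          IsBandLimited K Φ₂ ∧ 0 ≤ M ∧ 0 ≤ δ ∧
          StrainBound Φ₂ ((∫ x, ‖f x‖ ^ 2) / (16 * Real.pi ^ 4 * ν ^ 2)) M ∧
          1 + M < Λ * (4 * Real.pi ^ 2 * ν * (K : ℝ) ^ 2) ∧
          (2 * M * Real.sqrt ((∫ x, ‖f x‖ ^ 2) / (16 * Real.pi ^ 4 * ν ^ 2))) ^ 2 /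
              (4 * (Λ * (4 * Real.pi ^ 2 * ν * (K : ℝ) ^ 2) - 1 - M)) ≤ δ ∧
          ∀ (u a : H³), rep a =ᵐ[volume] fourierTruncate K (rep u) → eGradNormSq (rep a) ≠ ⊤ →
            ‖a‖ ^ 2 ≤ (∫ x, ‖f x‖ ^ 2) / (16 * Real.pi ^ 4 * ν ^ 2) →
              δ ≤ E - ‖a‖ ^ 2 +
                Literature.Analysis.FluidPDE.Torus.nsGeneratorPairing ν f a (Φ₂.grad a) +
                  Λ * (ν * (eGradNormSq (rep a)).toReal -
                    Literature.Analysis.FluidPDE.Torus.pairing (a : L2T) f))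

/-- PROVED (assembly of the card): priced Galerkin pairs decide X, given the two lift lemmas and
companions. -/
theorem x_of_pricedGalerkinPair (hT : TailPricingFloor) (hC : TruncationCompanion)
    (hL : PricedGalerkinCeilingLift) :
    PricedGalerkinPair →
      Summit.AnomalousDissipation.AnomalousDissipation.Theses.TaylorCertificates.FloorCertificateEnsembleCeiling := by
  rintro ⟨f, hfs, hfd, hfz, ε₀, E, ν₀, hε₀, hν₀, h⟩
  rw [← x'_iff]
  refine ⟨f, hfs, hfd, hfz, ε₀, E, ν₀, hε₀, hν₀, fun ν hν hνlt => ?_⟩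
  obtain ⟨K, hfK, hfloor, hceil⟩ := h ν hν hνlt
  exact ⟨floorAt_of_pricedGalerkin hT hC hfs hν hfK hfloor, hL ν E K f hν hfs hfd hfz hfK hceil⟩

/-- FINITE-DIMENSIONAL DUAL READING (statement; the bridge is the tree's named fact
`Literature.Dynamics.Ergodic.TobascoGoluskinDoering2018_measureForm`): at fixed `(ν, K)`, floor
certificates of level `ε` for the Galerkin-`K` ODE on its (forward-invariant, compact) Leray ball
exist for every `ε < m_K(ν) :=` the least mean dissipation `ν∫|∇a|²dm` over invariant probability
measures `m` of the truncation — so, up to the steepness budget, `PricedGalerkinFloorAt` is ROBUST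
LOUDNESS OF SUPER-RESOLVED DNS. Recorded as the card's dynamic target, not used by the glue. -/
def GalerkinLoudness (f : 𝕋³ → E³) (ε ν : ℝ) (K : ℕ) : Prop :=
  ∀ m : MeasureTheory.Measure H³, MeasureTheory.IsProbabilityMeasure m →
    (∀ᵐ a ∂m, rep a =ᵐ[volume] fourierTruncate K (rep a)) →
    (∀ Φ : Literature.Analysis.FluidPDE.Torus.CylindricalTest (Fin 3), IsBandLimited K Φ →
      ∫ a, Literature.Analysis.FluidPDE.Torus.nsGeneratorPairing ν f a (Φ.grad a) ∂m = 0) →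
    m {a | 16 * (∫ x, ‖f x‖ ^ 2) / ν ^ 2 < ‖a‖ ^ 2} = 0 →
      ε ≤ ∫ a, ν * (eGradNormSq (rep a)).toReal ∂m

end Summit.AnomalousDissipation.AnomalousDissipation.Cruxes.FloorCertificateEnsembleCeiling.Ideator2
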